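import Summits.CriticalPhenomena.CardyFormulaZ2.Theorems.CardyMagicRigidityNestingRigidityBigLoopsExpMomentBK
import Summits.CriticalPhenomena.CardyFormulaZ2.Theorems.CardyMagicRigidityNestingRigidityGapTower
import Summits.CriticalPhenomena.CardyFormulaZ2.Theorems.CardyMagicRigidityNestingRigiditySiteColourFlip
import Summits.CriticalPhenomena.CardyFormulaZ2.Theorems.CardyMagicRigidityLoopLimitZ2EqTSiteEndOuterBoundary
import HarnessLib

/-!
# Crux `NestingRigidity`, line `positive-cone-weight-doubling`: the deterministic core of the
# global BK step of keystone K6 on site-`𝕋` (disjoint families of typed loops ⇒ joint disjoint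
# occurrence of confined arms), and colour-flip self-symmetry

Crux `Summit.CriticalPhenomena.CardyFormulaZ2.Theses.CardyMagicRigidity.NestingRigidity`
(stmt-CriticalPhenomena-4835), line `positive-cone-weight-doubling`, keystone stub K6
`expMoment_ncard_bigLoops_le`; site-`𝕋` companion of `…BigLoopsExpMomentBK` (bond-`ℤ²`).  With no
cited fact and no definition:

* §1 **type `1`** (`BigLoopsExp.mem_foldr_triArm_of_typeOne_families`): pairwise disjoint finite
  families `T i` of counter-clockwise (type-`1`, positive shoelace sum) loops of
  `siteLoopConfig δ ω`, the loops of `T i` meeting `B̄(c i, a i)` and `ℂ ∖ B(c i, b i)`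
  (`a i + 5δ ≤ b i`), put `ω` in the joint disjoint occurrence
  `List.foldr disjointOccurrence univ (List.ofFn fun i ↦ (triArm δ (c i) (a i + 3δ) (b i - 2δ))^{□ k i})`
  for all `k i ≤ #T i`.  Witness of a loop = the open cluster of its left sites: distinct type-`1`
  loops have distinct left clusters (`HexSegment.siteEnd_unbasedLoop_eq_of_pathIn`, "a cluster has
  one exterior boundary", `…LoopLimitZ2EqTSiteEndOuterBoundary`), and the left cluster by itself is a
  configuration of which the loop is still an interface loop, so it contains a confined open arm
  across the annulus (`GapCrossing.mem_conf_of_isSiteInterfaceLoop`, `…GapTower`);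
* §2 **type `0` by colour flip** (`BigLoopsExp.mem_foldr_triArm_compl_of_typeZero_families`):
  clockwise loops of `ω` are reversed counter-clockwise loops of `ωᶜ`
  (`mem_siteLoopConfig_compl_iff`, `…SiteColourFlip`), so the same holds for `ωᶜ`;
* §3 **colour-flip symmetry of `P_{1/2}`** (`BigLoopsExp.measure_preimage_compl_le`, from
  `PT_map_compl`).
-/

noncomputable section

open MeasureTheory Set Filter Metric
open scoped Real Topology BigOperators ENNReal

namespace Summit.CriticalPhenomena.CardyFormulaZ2.Cruxes.NestingRigidity.PositiveConeWeightDoubling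

open Literature.Probability.RandomPlanarGeometry Literature.Probability.Percolation
  Literature.Probability.LatticeModels
open Summit.CriticalPhenomena.CardyFormulaZ2.Cruxes.NestingRigidity.RingCloudTomography
open Summit.CriticalPhenomena.CardyFormulaZ2.Cruxes.NestingRigidity.MarkovCascadeOneGeneration
  (range_mk_siteLoopCurve_eq_polyTrace mem_siteLoopConfig_compl_iff PT_map_compl)
open Summit.CriticalPhenomena.CardyFormulaZ2.Cruxes.LoopLimitZ2EqT.HexSegment
  (siteEnd_unbasedLoop_eq_of_pathIn)

namespace BigLoopsExp

/-! ## §1 Site-`𝕋`: disjoint families of counter-clockwise crossing loops -/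

/-- **An interface loop is an interface loop of the open cluster of its left sites**: all its left
sites lie in the cluster of the first one (`IsSiteInterfaceLoop.pathIn_lv`), its right sites are
closed, and the crossed dart of a step is determined by the two faces (`eq_of_triEdgeFaces_eq` is
not even needed: we exhibit the dart `(lv i, rv i)`). -/
theorem isSiteInterfaceLoop_leftCluster {ω : SiteConfig (Site 2)} {v : HexVertex}
    {γ : hexGraph.Walk v v} (hγ : IsSiteInterfaceLoop ω γ) :
    IsSiteInterfaceLoop {x | PathIn triGraph ω (hγ.lv 0) x} γ := by
  refine ⟨hγ.isCycle, fun d hd ↦ ?_⟩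
  obtain ⟨i, hi, rfl⟩ := List.getElem_of_mem hd
  have hi' : i < γ.length := by rwa [SimpleGraph.Walk.length_darts] at hi
  obtain ⟨hadj, hfaces, -, hrv⟩ := hγ.dart_spec hi'
  refine ⟨⟨(hγ.lv i, hγ.rv i), hadj⟩, ?_, hγ.pathIn_lv hi', fun h ↦ hrv h.right_mem⟩
  rw [hfaces, SimpleGraph.Walk.darts_getElem_eq_getVert i hi]

/-- **The left cluster of a crossing interface loop contains a confined open arm**: if the trace of
an interface loop of `ω` at mesh `δ > 0` has a point within `a` of `z` and a point at distance
`≥ b` from `z` (`a + 5δ ≤ b`), the open cluster of its left sites, as a configuration, lies in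
`triArm δ z (a + 3δ) (b - 2δ)` (`GapCrossing.mem_conf_of_isSiteInterfaceLoop` for the cluster
configuration, `isSiteInterfaceLoop_leftCluster`). -/
theorem leftCluster_mem_triArm {ω : SiteConfig (Site 2)} {v : HexVertex} {γ : hexGraph.Walk v v}
    (hγ : IsSiteInterfaceLoop ω γ) {δ : ℝ} (hδ : 0 < δ) (z : ℂ) {a b : ℝ} (hab : a + 5 * δ ≤ b)
    {y y' : ℂ} (hy : y ∈ polyTrace δ γ) (hy' : y' ∈ polyTrace δ γ) (hya : dist y z ≤ a)
    (hy'b : b ≤ dist y' z) :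
    {x | PathIn triGraph ω (hγ.lv 0) x} ∈ triArm δ z (a + 3 * δ) (b - 2 * δ) := by
  obtain ⟨p, q, w, hp, hq, hw⟩ :=
    GapCrossing.mem_conf_of_isSiteInterfaceLoop (isSiteInterfaceLoop_leftCluster hγ) hδ z hab hy hy'
      hya hy'b
  refine ⟨w.length, fun i ↦ w.getVert i, ?_, ?_, fun i hi ↦ Or.inr (w.adj_getVert_succ hi),
    fun i _ ↦ ?_⟩
  · dsimp only
    rw [SimpleGraph.Walk.getVert_zero, dist_eq_norm]
    exact hp.le
  · dsimp only
    rw [SimpleGraph.Walk.getVert_length, dist_eq_norm]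
    exact hq.le
  · obtain ⟨h₁, -, h₃⟩ := hw _ (w.getVert_mem_support i)
    refine ⟨?_, h₁⟩
    rw [dist_eq_norm]
    linarith

/-- **Deterministic core of K6 on site-`𝕋`, type `1`.**  At mesh `δ > 0`, with `a i + 5δ ≤ b i`:
pairwise disjoint finite families `T i` (`i : Fin B`) of counter-clockwise (type-`1`) loops of
`siteLoopConfig δ ω`, every loop of `T i` meeting `B̄(c i, a i)` and `ℂ ∖ B(c i, b i)`, put `ω` in
the joint disjoint occurrence of the confined arm events `(triArm δ (c i) (a i + 3δ) (b i - 2δ))^{□ k i}`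
for all `k i ≤ #T i`: the witnesses are the open left clusters, pairwise disjoint for distinct
type-`1` loops (`siteEnd_unbasedLoop_eq_of_pathIn`), each containing a confined arm across the
annulus of its loop (`leftCluster_mem_triArm`). -/
theorem mem_foldr_triArm_of_typeOne_families {ω : SiteConfig (Site 2)} {δ : ℝ} (hδ : 0 < δ)
    {B : ℕ} {a b : Fin B → ℝ} (hab : ∀ i, a i + 5 * δ ≤ b i) (c : Fin B → ℂ)
    (T : Fin B → Set (UnbasedLoop ℂ)) (hT : ∀ i, T i ⊆ (siteLoopConfig δ ω).F 1)
    (hTfin : ∀ i, (T i).Finite) (hTdisj : Pairwise fun i i' ↦ Disjoint (T i) (T i'))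
    (hmeet : ∀ i, ∀ u ∈ T i, (u.range ∩ Metric.closedBall (c i) (a i)).Nonempty ∧
      (u.range ∩ (Metric.ball (c i) (b i))ᶜ).Nonempty)
    (k : Fin B → ℕ) (hk : ∀ i, k i ≤ (T i).ncard) :
    ω ∈ (List.ofFn fun i ↦ disjointOccurrencePow
      (triArm δ (c i) (a i + 3 * δ) (b i - 2 * δ)) (k i)).foldr disjointOccurrence univ := by
  classical
  -- `k i` distinct loops of `T i` (as in `mem_foldr_of_typeOne_families`)
  have hsel : ∀ i, ∃ u : Fin (k i) → UnbasedLoop ℂ, Function.Injective u ∧ ∀ j, u j ∈ T i := by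
    intro i
    have hcard : k i ≤ (hTfin i).toFinset.card := by
      rw [← Set.ncard_eq_toFinset_card (T i) (hTfin i)]; exact hk i
    refine ⟨fun j ↦ ((hTfin i).toFinset.equivFin.symm (Fin.castLE hcard j) : UnbasedLoop ℂ),
      fun j j' h ↦ ?_, fun j ↦ ?_⟩
    · exact Fin.castLE_injective hcard
        ((hTfin i).toFinset.equivFin.symm.injective (Subtype.ext h))
    · exact (hTfin i).mem_toFinset.1 ((hTfin i).toFinset.equivFin.symm (Fin.castLE hcard j)).2
  choose u huinj huT using hsel
  have hne : ∀ a a' : (Σ i : Fin B, Fin (k i)), a ≠ a' → u a.1 a.2 ≠ u a'.1 a'.2 := by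
    rintro ⟨i, j⟩ ⟨i', j'⟩ haa' heq
    dsimp only at heq
    by_cases hii' : i = i'
    · subst hii'
      exact haa' (by rw [huinj i heq])
    · exact Set.disjoint_left.1 (hTdisj hii') (huT i j) (by rw [heq]; exact huT i' j')
  -- representatives: type-`1` interface loops
  have hrep : ∀ a : (Σ i : Fin B, Fin (k i)), ∃ (v : HexVertex) (γ : hexGraph.Walk v v),
      IsSiteInterfaceLoop ω γ ∧ ((1 : Fin 2) = 1 ↔ 0 < shoelace (γ.support.map hexCenter)) ∧
      u a.1 a.2 = UnbasedLoop.mk (BasedLoop.mk (siteLoopCurve δ γ) (isLoop_siteLoopCurve δ γ)) :=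
    fun a ↦ mem_siteLoopConfig_iff.1 (hT a.1 (huT a.1 a.2))
  choose v γ hγ htyp hγu using hrep
  have hpos : ∀ a, 0 < shoelace ((γ a).support.map hexCenter) := fun a ↦ (htyp a).1 rfl
  have hrange : ∀ a, (u a.1 a.2).range = polyTrace δ (γ a) := fun a ↦ by
    rw [hγu a]; exact range_mk_siteLoopCurve_eq_polyTrace (hγ a)
  refine mem_foldr_ofFn_of_pairwise_disjoint (fun i ↦ isUpperSet_triArm δ (c i) _ _)
    (fun a ↦ {x | PathIn triGraph ω ((hγ a).lv 0) x}) (fun a x hx ↦ hx.right_mem)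
    (fun a ↦ ?_) (fun a a' haa' ↦ ?_)
  · obtain ⟨⟨y, hyu, hya⟩, ⟨y', hy'u, hy'b⟩⟩ := hmeet a.1 _ (huT a.1 a.2)
    rw [hrange a] at hyu hy'u
    exact leftCluster_mem_triArm (hγ a) hδ (c a.1) (hab a.1) hyu hy'u (mem_closedBall.1 hya)
      (not_lt.1 fun hlt ↦ hy'b (mem_ball.2 hlt))
  · refine Set.disjoint_left.2 fun x hx hx' ↦ hne a a' haa' ?_
    rw [hγu a, hγu a']
    exact siteEnd_unbasedLoop_eq_of_pathIn (hγ a) (hγ a') (hpos a) (hpos a') (hx.trans hx'.symm) δ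

/-! ## §2 Site-`𝕋`: clockwise loops, through the colour flip -/

/-- **Deterministic core of K6 on site-`𝕋`, type `0`.**  The same for pairwise disjoint finite
families `T i` of clockwise (type-`0`) loops of `siteLoopConfig δ ω`: then the flipped configuration
`ωᶜ` lies in the joint disjoint occurrence of the confined arm events about the same centres — the
reversal of a clockwise loop of `ω` is a counter-clockwise loop of `ωᶜ` with the same trace
(`mem_siteLoopConfig_compl_iff`, `UnbasedLoop.range_reverse`), injectively; then §1 for `ωᶜ`. -/
theorem mem_foldr_triArm_compl_of_typeZero_families {ω : SiteConfig (Site 2)} {δ : ℝ} (hδ : 0 < δ)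
    {B : ℕ} {a b : Fin B → ℝ} (hab : ∀ i, a i + 5 * δ ≤ b i) (c : Fin B → ℂ)
    (T : Fin B → Set (UnbasedLoop ℂ)) (hT : ∀ i, T i ⊆ (siteLoopConfig δ ω).F 0)
    (hTfin : ∀ i, (T i).Finite) (hTdisj : Pairwise fun i i' ↦ Disjoint (T i) (T i'))
    (hmeet : ∀ i, ∀ u ∈ T i, (u.range ∩ Metric.closedBall (c i) (a i)).Nonempty ∧
      (u.range ∩ (Metric.ball (c i) (b i))ᶜ).Nonempty)
    (k : Fin B → ℕ) (hk : ∀ i, k i ≤ (T i).ncard) :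
    ωᶜ ∈ (List.ofFn fun i ↦ disjointOccurrencePow
      (triArm δ (c i) (a i + 3 * δ) (b i - 2 * δ)) (k i)).foldr disjointOccurrence univ := by
  have hinj : Function.Injective (UnbasedLoop.reverse : UnbasedLoop ℂ → UnbasedLoop ℂ) :=
    fun u₁ u₂ h ↦ by rw [← UnbasedLoop.reverse_reverse u₁, h, UnbasedLoop.reverse_reverse]
  refine mem_foldr_triArm_of_typeOne_families hδ hab c (fun i ↦ UnbasedLoop.reverse '' T i)
    (fun i ↦ ?_) (fun i ↦ (hTfin i).image _)
    (fun i i' hii' ↦ (Set.disjoint_image_iff hinj).2 (hTdisj hii')) (fun i ↦ ?_) k (fun i ↦ ?_)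
  · rintro _ ⟨u, hu, rfl⟩
    rw [mem_siteLoopConfig_compl_iff δ ω 1 u.reverse, UnbasedLoop.reverse_reverse]
    exact hT i hu
  · rintro _ ⟨u, hu, rfl⟩
    rw [UnbasedLoop.range_reverse]
    exact hmeet i u hu
  · rw [Set.ncard_image_of_injective _ hinj]
    exact hk i

/-! ## §3 Colour-flip symmetry of critical site percolation -/

/-- **Events pulled back by the colour flip have the same `P_{1/2}`-probability bound** (the law of
`ωᶜ` under `P_{1/2}` is `P_{1/2}`, `PT_map_compl`). -/
theorem measure_preimage_compl_le (E : Set (SiteConfig (Site 2))) :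
    triSitePercolation half (compl ⁻¹' E) ≤ triSitePercolation half E := by
  have h : (triSitePercolation half).map compl = triSitePercolation half := PT_map_compl
  calc triSitePercolation half (compl ⁻¹' E)
      ≤ (triSitePercolation half).map compl E := Measure.le_map_apply measurable_compl.aemeasurable E
    _ = triSitePercolation half E := by rw [h]

end BigLoopsExp

/-! ## §4 Anchor: the type-`1` core on `tEns` in registered form -/

/-- **Anchor (helper toward K6 `expMoment_ncard_bigLoops_le`).**  On `tEns` (site-`𝕋`) at mesh
`δ > 0`: pairwise disjoint finite families `T i` of counter-clockwise loops of `tEns.X δ ω`, the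
loops of `T i` meeting `B̄(c i, a i)` and `ℂ ∖ B(c i, b i)` (`a i + 5δ ≤ b i`), put `ω` in the joint
disjoint occurrence of the confined arm events `(triArm δ (c i) (a i + 3δ) (b i - 2δ))^{□ k i}`, for
all `k i ≤ #T i` (`BigLoopsExp.mem_foldr_triArm_of_typeOne_families`). -/
theorem mem_foldr_triArm_of_typeOne_tEns : ∀ (ω : SiteConfig (Site 2)) (δ : ℝ) (B : ℕ) (a b : Fin B → ℝ) (c : Fin B → ℂ) (T : Fin B → Set (UnbasedLoop ℂ)) (k : Fin B → ℕ), 0 < δ → (∀ i, a i + 5 * δ ≤ b i) → (∀ i, T i ⊆ (tEns.X δ ω).F 1) → (∀ i, (T i).Finite) → (Pairwise fun i i' ↦ Disjoint (T i) (T i')) → (∀ i, ∀ u ∈ T i, (u.range ∩ Metric.closedBall (c i) (a i)).Nonempty ∧ (u.range ∩ (Metric.ball (c i) (b i))ᶜ).Nonempty) → (∀ i, k i ≤ (T i).ncard) → ω ∈ (List.ofFn fun i ↦ disjointOccurrencePow (triArm δ (c i) (a i + 3 * δ) (b i - 2 * δ)) (k i)).foldr disjointOccurrence Set.univ := by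
  intro ω δ B a b c T k hδ hab hT hTfin hTdisj hmeet hk
  exact BigLoopsExp.mem_foldr_triArm_of_typeOne_families hδ hab c T hT hTfin hTdisj hmeet k hk

end Summit.CriticalPhenomena.CardyFormulaZ2.Cruxes.NestingRigidity.PositiveConeWeightDoubling

end
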